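import Mathlib
import Summits.ValiantsHypothesis.ValiantsHypothesis.Theorems.BarrierLeverPartitionMinorsHitByVPHiddenStatesSecondShellSurjection
import Summits.ValiantsHypothesis.ValiantsHypothesis.Theorems.BarrierLeverPartitionMinorsHitByVPHiddenStatesPathTableTransfer

/-!
# Route BarrierLever — item `PartitionMinorsHitByVP` (stmt-ValiantsHypothesis-19717), line `hidden-states`:
# THE MASTER SUM AS A SIGNED COUNT OF CONFIGURATIONS (one-collision first steps × vertex-disjoint path systems)

Helper file (`--supports stmt-ValiantsHypothesis-19717`; cell valiant-natproofs, 𝒟-side door (c), registered line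
`Cruxes/PartitionMinorsHitByVP/Lines/hidden_states.lean` v9; prover seat val-np-p6 gen 19).  Closes NO item.  Transparent
definitions only (`fnOn`, `mov`, `cfgSet`, `cfgWeight`).

THE MECHANISM (memo HOME/val-np-p6/g19/MEMO-valnp6-g19.md, Theorem C, first half).  The master sum
`Λ = Σ_S Sur[C',S]·DPS(S → A)` of `…SecondShellMaster` is a signed sum over CONFIGURATIONS `(f, g)`: `f` the first steps of the
tokens of `C'` (identity off `C'`, exactly one collision: `|f(C')| = t`), `g` the successor map of a vertex-disjoint path system
from `f(C')` onto `A` (`mov g = {u : g u ≠ u}` = the non-terminal path vertices, disjoint from `A`; `g(mov g) = (A ∪ mov g) ∖ f(C')`);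
weight `∏_{u ∈ C'} w u (f u) · (−1)^{|mov g|} ∏_{u ∈ mov g} w u (g u)` (★ `master_sum_eq_sum_cfg`; via ★ `sur_eq_sum_fnOn`, the
surjection sum as a sum over maps, and ★ `dps_eq_sum_fnOn`).  The cancellation to REDUCED configurations is `…SecondShellReduced`.

HONEST LABEL: conjecture-column toolkit (second shell, every `t, h`); 19717 stays OPEN; nothing on crux 14610 or VP ≠ VNP.
-/

set_option linter.dupNamespace false

namespace Summit.ValiantsHypothesis.ValiantsHypothesis.Theorems.BarrierLever.HiddenStates

open Finset

noncomputable section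

namespace SecondShell

open PathTable (mono_expand)

variable {ι : Type} [Fintype ι] [DecidableEq ι]

/-! ## Maps supported on a set, and the surjection sum as a sum over maps -/

/-- the maps `ι → ι` that are the identity outside `R` (values on `R` arbitrary). -/
def fnOn (R : Finset ι) : Finset (ι → ι) :=
  Fintype.piFinset fun a => if a ∈ R then (Finset.univ : Finset ι) else {a}

/-- membership in `fnOn R`: the identity outside `R`. -/
theorem mem_fnOn {R : Finset ι} {φ : ι → ι} : φ ∈ fnOn R ↔ ∀ a, a ∉ R → φ a = a := by
  unfold fnOn
  rw [Fintype.mem_piFinset]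
  constructor
  · intro h a ha; have := h a; rw [if_neg ha, Finset.mem_singleton] at this; exact this
  · intro h a
    by_cases ha : a ∈ R
    · rw [if_pos ha]; exact Finset.mem_univ _
    · rw [if_neg ha, Finset.mem_singleton]; exact h a ha

/-- the alternating sum over an interval of the Boolean lattice: `Σ_{P ⊆ S' ⊆ S} (−1)^{|S|+|S'|} = [P = S]`. -/
theorem sum_powerset_interval_neg_one_pow (P S : Finset ι) :
    ∑ S' ∈ S.powerset, (if P ⊆ S' then (-1 : ℂ) ^ (S.card + S'.card) else 0) = if P = S then 1 else 0 := by
  by_cases hPS : P ⊆ S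
  · -- reindex `S' = P ∪ T`, `T ⊆ S ∖ P`
    have himg : (S.powerset.filter fun S' => P ⊆ S') = (S \ P).powerset.image fun T => P ∪ T := by
      ext S'
      simp only [Finset.mem_filter, Finset.mem_powerset, Finset.mem_image]
      constructor
      · rintro ⟨h1, h2⟩
        refine ⟨S' \ P, Finset.sdiff_subset_sdiff h1 le_rfl, ?_⟩
        rw [Finset.union_sdiff_of_subset h2]
      · rintro ⟨T, hT, rfl⟩
        exact ⟨Finset.union_subset hPS (hT.trans Finset.sdiff_subset), Finset.subset_union_left⟩
    rw [← Finset.sum_filter, himg, Finset.sum_image]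
    · have h2 : ∀ T ∈ (S \ P).powerset, ((-1 : ℂ) ^ (S.card + (P ∪ T).card)) = (-1) ^ (S.card + P.card) * (-1) ^ T.card := by
        intro T hT
        have hdisj : Disjoint P T := Finset.disjoint_of_subset_right (Finset.mem_powerset.1 hT) Finset.disjoint_sdiff
        rw [Finset.card_union_of_disjoint hdisj, ← add_assoc, pow_add]
      rw [Finset.sum_congr rfl h2, ← Finset.mul_sum]
      have hz := congrArg (Int.cast : ℤ → ℂ) (Finset.sum_powerset_neg_one_pow_card (x := S \ P))
      push_cast at hz
      rw [hz]
      by_cases hP : P = S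
      · subst hP; simp
      · have hne : S \ P ≠ ∅ := by
          intro h; apply hP
          exact (Finset.Subset.antisymm hPS (Finset.sdiff_eq_empty_iff_subset.1 h))
        rw [if_neg hne, if_neg hP, mul_zero]
    · intro T hT T' hT' hEq
      have h1 : Disjoint P T := Finset.disjoint_of_subset_right (Finset.mem_powerset.1 hT) Finset.disjoint_sdiff
      have h2 : Disjoint P T' := Finset.disjoint_of_subset_right (Finset.mem_powerset.1 hT') Finset.disjoint_sdiff
      have := congrArg (fun X => X \ P) hEq
      simp only [Finset.union_sdiff_left] at this
      rwa [Finset.sdiff_eq_self_of_disjoint h1.symm, Finset.sdiff_eq_self_of_disjoint h2.symm] at this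
  · have hne : ¬ P = S := fun h => hPS (by rw [h])
    rw [if_neg hne]
    refine Finset.sum_eq_zero fun S' hS' => ?_
    rw [if_neg]
    exact fun h => hPS (h.trans (Finset.mem_powerset.1 hS'))

/-- ★ **the surjection sum as a sum over maps**: `Sur[R,S] = Σ_{φ = id off R, φ(R) = S} ∏_{a ∈ R} w a (φ a)`. -/
theorem sur_eq_sum_fnOn (w : ι → ι → ℂ) (R S : Finset ι) :
    sur w R S = ∑ φ ∈ fnOn R, (∏ a ∈ R, w a (φ a)) * (if R.image φ = S then 1 else 0) := by
  unfold sur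
  have h1 : ∀ S' ∈ S.powerset, ((-1 : ℂ) ^ (S.card + S'.card) * ∏ a ∈ R, ∑ q ∈ S', w a q) =
      ∑ φ ∈ fnOn R, (∏ a ∈ R, w a (φ a)) * (if R.image φ ⊆ S' then (-1 : ℂ) ^ (S.card + S'.card) else 0) := by
    intro S' _
    unfold fnOn
    rw [mono_expand w R S', Finset.mul_sum]
    refine Finset.sum_congr rfl fun φ _ => ?_
    have : (∀ a ∈ R, φ a ∈ S') ↔ R.image φ ⊆ S' := by rw [Finset.image_subset_iff]
    by_cases h : R.image φ ⊆ S'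
    · rw [if_pos (this.2 h), if_pos h]; ring
    · rw [if_neg (fun h' => h (this.1 h')), if_neg h]; ring
  rw [Finset.sum_congr rfl h1, Finset.sum_comm]
  refine Finset.sum_congr rfl fun φ _ => ?_
  rw [← Finset.mul_sum, sum_powerset_interval_neg_one_pow]

/-! ## Configurations -/

/-- the non-fixed points of a map (the non-terminal vertices of its path system). -/
def mov (g : ι → ι) : Finset ι := Finset.univ.filter fun u => g u ≠ u

/-- membership in `mov g`. -/
theorem mem_mov {g : ι → ι} {u : ι} : u ∈ mov g ↔ g u ≠ u := by
  unfold mov; simp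

/-- the VALID configurations `(f, g)` for the cross minor `D(A ← C')`: `f` the first steps (identity off `C'`, one collision:
`|f(C')| = t`), `g` the successor map of a path system from `f(C')` onto `A` (`mov g ∩ A = ∅`, `g(mov g) = (A ∪ mov g) ∖ f(C')`). -/
def cfgSet (C' A : Finset ι) (t : ℕ) : Finset ((ι → ι) × (ι → ι)) :=
  (fnOn C' ×ˢ fnOn Finset.univ).filter fun p =>
    (C'.image p.1).card = t ∧ Disjoint (mov p.2) A ∧ C'.image p.1 ⊆ A ∪ mov p.2 ∧
      (mov p.2).image p.2 = (A ∪ mov p.2) \ C'.image p.1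

/-- membership in `cfgSet`. -/
theorem mem_cfgSet {C' A : Finset ι} {t : ℕ} {p : (ι → ι) × (ι → ι)} :
    p ∈ cfgSet C' A t ↔ p.1 ∈ fnOn C' ∧ ((C'.image p.1).card = t ∧ Disjoint (mov p.2) A ∧
      C'.image p.1 ⊆ A ∪ mov p.2 ∧ (mov p.2).image p.2 = (A ∪ mov p.2) \ C'.image p.1) := by
  unfold cfgSet
  rw [Finset.mem_filter, Finset.mem_product]
  have h2 : p.2 ∈ fnOn (Finset.univ : Finset ι) := mem_fnOn.2 fun a ha => absurd (Finset.mem_univ a) ha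
  tauto

/-- the signed weight of a configuration. -/
def cfgWeight (w : ι → ι → ℂ) (C' : Finset ι) (p : (ι → ι) × (ι → ι)) : ℂ :=
  (∏ u ∈ C', w u (p.1 u)) * ((-1) ^ (mov p.2).card * ∏ u ∈ mov p.2, w u (p.2 u))

/-! ## ★ The master sum is the signed count of valid configurations -/

/-- the permanent of the off-diagonal table as a sum over successor maps. -/
theorem dps_eq_sum_fnOn (w : ι → ι → ℂ) (S A : Finset ι) :
    dps w Finset.univ S A = ∑ g ∈ fnOn Finset.univ,
      if Disjoint (mov g) A ∧ S ⊆ A ∪ mov g ∧ (mov g).image g = (A ∪ mov g) \ S then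
        (-1) ^ (mov g).card * ∏ u ∈ mov g, w u (g u) else 0 := by
  classical
  unfold dps
  set nd : ι → ι → ℂ := fun u v => if v = u then 0 else w u v with hnd
  -- Step 1: each permanent as a sum over maps supported on `U ∖ A`
  have h1 : ∀ U ∈ (Finset.univ : Finset ι).powerset, (if S ⊆ U ∧ A ⊆ U then
      (-1) ^ (U \ A).card * sur nd (U \ A) (U \ S) else 0) =
      ∑ g ∈ fnOn Finset.univ, (if g ∈ fnOn (U \ A) ∧ (S ⊆ U ∧ A ⊆ U) ∧ (U \ A).image g = U \ S then
        (-1) ^ (U \ A).card * ∏ u ∈ U \ A, nd u (g u) else 0) := by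
    intro U _
    by_cases hc : S ⊆ U ∧ A ⊆ U
    · rw [if_pos hc, sur_eq_sum_fnOn, Finset.mul_sum]
      rw [← Finset.sum_subset (s₁ := fnOn (U \ A)) (s₂ := fnOn Finset.univ)
        (fun g hg => mem_fnOn.2 fun a ha => absurd (Finset.mem_univ a) ha)]
      · refine Finset.sum_congr rfl fun g hg => ?_
        by_cases hi : (U \ A).image g = U \ S
        · rw [if_pos hi, if_pos ⟨hg, hc, hi⟩]; ring
        · rw [if_neg hi, if_neg (fun h => hi h.2.2)]; ring
      · intro g _ hg; rw [if_neg (fun h => hg h.1)]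
    · rw [if_neg hc]; symm
      exact Finset.sum_eq_zero fun g _ => by rw [if_neg (fun h => hc h.2.1)]
  rw [Finset.sum_congr rfl h1, Finset.sum_comm]
  refine Finset.sum_congr rfl fun g _ => ?_
  -- Step 2: for a fixed `g` only `U = A ∪ mov g` can contribute
  by_cases hdisj : Disjoint (mov g) A
  · rw [Finset.sum_eq_single (A ∪ mov g)]
    · -- the main term
      have hUA : (A ∪ mov g) \ A = mov g := by
        rw [Finset.union_sdiff_left, Finset.sdiff_eq_self_of_disjoint hdisj]
      have hgfn : g ∈ fnOn (mov g) := by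
        rw [mem_fnOn]; intro a ha; by_contra h; exact ha (mem_mov.2 h)
      simp only [hUA]
      by_cases hc : S ⊆ A ∪ mov g ∧ (mov g).image g = (A ∪ mov g) \ S
      · rw [if_pos ⟨hgfn, ⟨hc.1, Finset.subset_union_left⟩, hc.2⟩, if_pos ⟨hdisj, hc.1, hc.2⟩]
        congr 1
        refine Finset.prod_congr rfl fun u hu => ?_
        have hgu : g u ≠ u := mem_mov.1 hu
        simp only [hnd, if_neg hgu]
      · rw [if_neg, if_neg (fun h => hc ⟨h.2.1, h.2.2⟩)]
        rintro ⟨-, ⟨hS, -⟩, hi⟩; exact hc ⟨hS, hi⟩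
    · -- other `U`: either `g ∉ fnOn (U ∖ A)` or a fixed point of `g` inside `U ∖ A` kills the weight
      intro U _ hU
      rw [ite_eq_right_iff]
      rintro ⟨hg, ⟨-, hAU⟩, -⟩
      have hsub : mov g ⊆ U \ A := by
        intro u hu
        by_contra h
        exact (mem_mov.1 hu) ((mem_fnOn.1 hg) u h)
      have hne : mov g ≠ U \ A := by
        intro h; apply hU
        rw [h, Finset.union_sdiff_of_subset hAU]
      obtain ⟨u, hu, hu'⟩ := Finset.exists_of_ssubset (lt_of_le_of_ne hsub hne)
      have hgu : g u = u := by by_contra h; exact hu' (mem_mov.2 h)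
      rw [Finset.prod_eq_zero hu (by simp only [hnd, hgu, if_pos rfl]), mul_zero]
    · intro h; exact absurd (Finset.mem_powerset.2 (Finset.subset_univ _)) h
  · rw [if_neg (fun h => hdisj h.1)]
    refine Finset.sum_eq_zero fun U _ => ?_
    rw [ite_eq_right_iff]
    rintro ⟨hg, -, -⟩
    exfalso; apply hdisj
    rw [Finset.disjoint_left]
    intro u hu huA
    exact (mem_mov.1 hu) ((mem_fnOn.1 hg) u (fun h => (Finset.mem_sdiff.1 h).2 huA))

/-- ★ **THE MASTER SUM AS A SIGNED COUNT OF CONFIGURATIONS.** -/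
theorem master_sum_eq_sum_cfg (w : ι → ι → ℂ) (C' A : Finset ι) (t : ℕ) :
    ∑ S ∈ (Finset.univ : Finset ι).powersetCard t, sur w C' S * dps w Finset.univ S A =
      ∑ p ∈ cfgSet C' A t, cfgWeight w C' p := by
  classical
  unfold cfgSet
  rw [Finset.sum_filter, Finset.sum_product]
  -- collapse the sum over `S` onto `S = C'.image f`
  have h1 : ∀ S ∈ (Finset.univ : Finset ι).powersetCard t, sur w C' S * dps w Finset.univ S A =
      ∑ f ∈ fnOn C', (if C'.image f = S then (∏ a ∈ C', w a (f a)) * dps w Finset.univ (C'.image f) A else 0) := by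
    intro S _
    rw [sur_eq_sum_fnOn, Finset.sum_mul]
    refine Finset.sum_congr rfl fun f _ => ?_
    by_cases h : C'.image f = S
    · rw [if_pos h, if_pos h, h, mul_one]
    · rw [if_neg h, if_neg h, mul_zero, zero_mul]
  rw [Finset.sum_congr rfl h1, Finset.sum_comm]
  refine Finset.sum_congr rfl fun f _ => ?_
  rw [Finset.sum_ite_eq ((Finset.univ : Finset ι).powersetCard t) (C'.image f)]
  simp only [Finset.mem_powersetCard, Finset.subset_univ, true_and]
  by_cases ht : (C'.image f).card = t
  · rw [if_pos ht, dps_eq_sum_fnOn, Finset.mul_sum]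
    refine Finset.sum_congr rfl fun g _ => ?_
    unfold cfgWeight
    by_cases hc : Disjoint (mov g) A ∧ C'.image f ⊆ A ∪ mov g ∧ (mov g).image g = (A ∪ mov g) \ C'.image f
    · rw [if_pos hc, if_pos ⟨ht, hc⟩]
    · rw [if_neg hc, if_neg (fun h => hc h.2), mul_zero]
  · rw [if_neg ht]; symm
    refine Finset.sum_eq_zero fun g _ => ?_
    rw [if_neg (fun h => ht h.1)]

end SecondShell

end

end Summit.ValiantsHypothesis.ValiantsHypothesis.Theorems.BarrierLever.HiddenStates
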